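import Mathlib
import Summits.KontsevichZagierPeriods.Zeta5Search.BrickHoleResidueLawTwo
import Summits.KontsevichZagierPeriods.Zeta5Search.BrickHoleWeight
import Summits.KontsevichZagierPeriods.Zeta5Search.BrickLevelReduction

/-!
# BrickLevelReductionTwo — the ONE-LEVEL REDUCTION at the prime `2` for the CENTRE-FREE brick kernel, both row parities:
`Σ_{k≤n} g(k)·2^{(L+1)(A−s)}c̃_{k,s}(n) ≡ Σ_K W(K)·2^{L(A−s)}c̃_{K,s}(N) [+ Σ_K G(K)·2^{L(A−s)}c̃_{K,s}(N′)] (mod 2^{L+1})`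
with the chain's own block weight `W = blockWeight A B 0 2 n₀ N g` and hole weight `G = holeWeight A B 0 2 0 N′ g`
(the `p = 2` counterpart of `BrickLevelReductionInf.level_reduction_inf{,_zero}`; cell `pub-zeta5`, seat ct-1 g42)

HONEST FRAMING: systematic search; no irrationality claim unless certified.  INSTRUMENT congruences between weighted cell sums of
the centre-free brick kernel on two consecutive dyadic levels; nothing about `ζ(5)`/`ζ(3)`; no `γ`/record statement; records in
print UNMOVED; NOTHING IS DISCHARGED (net named-fact debt 0).

THE STATEMENTS (`2B ≤ A`, `1 ≤ B`, weight `g ∈ ℤ_(2)` on the row; `W`, `G` exactly the tree's `BrickLevelReduction.blockWeight`,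
`BrickHoleWeight.holeWeight` at `p = 2`, `ε = 0`):
* **`level_reduction_two_odd`** / **`level_reduction_two_odd_zero`** — ODD row `n = 2N+1 = 1 + N·2` (`n₀ = 1`: no holes), `N < 2^{L+1}`:
  `v₂(Σ_{k<2N+2} g(k)·2^{(L+1)(A−s)}c̃_{k,s}(2N+1) − Σ_{K<N+1} W(K)·2^{L(A−s)}c̃_{K,s}(N)) ≤ exp(−(L+1))`, and the harmonic cell;
* **`level_reduction_two_even`** / **`level_reduction_two_even_zero`** — EVEN row `n = 2N+2 = 0 + (N+1)·2` (`n₀ = 0`), `N+1 < 2^{L+1}`: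
  `v₂(Σ_{k<2N+3} g(k)·2^{(L+1)(A−s)}c̃_{k,s}(2N+2) − Σ_{K<N+2} W(K)·2^{L(A−s)}c̃_{K,s}(N+1) − Σ_{K<N+1} G(K)·2^{L(A−s)}c̃_{K,s}(N))
  ≤ exp(−(L+1))`, and the harmonic cell (`1 ≤ A`).
Termwise these are the residue laws of `BrickResidueLawTwo`, `BrickResidueLawTwoZero`, `BrickHoleResidueLawTwo` (λ's identified with
the top-coefficient ratios inside `W`, `G` by `cTop_two_*`), summed with the ultrametric inequality after the digit split at `2`
(`sum_range_even_odd`, `sum_range_even_odd_succ`).  NO parity hypothesis on `g` is needed HERE; it enters only in the next step of the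
chain («`W ≡ 0 (mod 2)`», cf. ct-1 g42's README §2).  Theorems only (0 `def`); tree vocabulary; nothing restated.
-/

namespace Summit.KontsevichZagierPeriods.Zeta5Search.BrickLevelReductionTwo

open Finset Nat Polynomial WithZero
open Summit.KontsevichZagierPeriods.Zeta5Search.BrickTopCoefficient (cTop)
open Summit.KontsevichZagierPeriods.Zeta5Search.BrickLaurent (laurent cell phiCoeff)
open Summit.KontsevichZagierPeriods.Zeta5Search.BrickPartialFractions (cellZero)
open Summit.KontsevichZagierPeriods.Zeta5Search.BrickLambda (cTop_zero_ne_zero)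
open Summit.KontsevichZagierPeriods.Zeta5Search.BrickLevelReduction (blockWeight)
open Summit.KontsevichZagierPeriods.Zeta5Search.BrickHoleWeight (holeWeight)
open Summit.KontsevichZagierPeriods.Zeta5Search.BrickResidueLawTwo (residueLaw_two_even residueLaw_two_odd_odd
  residueLaw_two_odd_even cTop_two_even cTop_two_odd_odd cTop_two_odd_even)
open Summit.KontsevichZagierPeriods.Zeta5Search.BrickResidueLawTwoZero (residueLawZero_two_even residueLawZero_two_odd_odd
  residueLawZero_two_odd_even)
open Summit.KontsevichZagierPeriods.Zeta5Search.BrickHoleResidueLawTwo (residueLaw_two_hat residueLawZero_two_hat cTop_two_hat)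

noncomputable section

/-! ## The digit split at `2` -/

/-- `Σ_{m < 2N+2} f(m) = Σ_{i ≤ N} f(2i) + Σ_{i ≤ N} f(2i+1)`. [folklore] -/
theorem sum_range_even_odd {M : Type*} [AddCommMonoid M] (f : ℕ → M) (N : ℕ) :
    ∑ m ∈ range (2 * N + 1 + 1), f m = (∑ i ∈ range (N + 1), f (2 * i)) + ∑ i ∈ range (N + 1), f (2 * i + 1) := by
  induction N with
  | zero => simp [Finset.sum_range_succ]
  | succ N ih =>
    have h1 : 2 * (N + 1) + 1 + 1 = (2 * N + 1 + 1) + 1 + 1 := by ring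
    rw [h1, Finset.sum_range_succ, Finset.sum_range_succ, ih, Finset.sum_range_succ _ (N + 1),
      Finset.sum_range_succ _ (N + 1)]
    have h3 : 2 * N + 1 + 1 + 1 = 2 * (N + 1) + 1 := by ring
    have h2 : 2 * N + 1 + 1 = 2 * (N + 1) := by ring
    rw [h3, h2]
    abel

/-- `Σ_{m < 2N+3} f(m) = Σ_{i ≤ N+1} f(2i) + Σ_{i ≤ N} f(2i+1)`. [folklore] -/
theorem sum_range_even_odd_succ {M : Type*} [AddCommMonoid M] (f : ℕ → M) (N : ℕ) :
    ∑ m ∈ range (2 * N + 2 + 1), f m = (∑ i ∈ range (N + 1 + 1), f (2 * i)) + ∑ i ∈ range (N + 1), f (2 * i + 1) := by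
  rw [show 2 * N + 2 + 1 = (2 * N + 1 + 1) + 1 by ring, Finset.sum_range_succ, sum_range_even_odd,
    Finset.sum_range_succ _ (N + 1), show 2 * N + 1 + 1 = 2 * (N + 1) by ring]
  abel

/-- The termwise congruence step: `v(g·X − g·λ·Y) ≤ b` from `v(X − λ·Y) ≤ b` and `g ∈ ℤ_(2)`. -/
theorem term_le {g X lam Y : ℚ} {b : ℤᵐ⁰} (hg : Rat.padicValuation 2 g ≤ 1)
    (h : Rat.padicValuation 2 (X - lam * Y) ≤ b) : Rat.padicValuation 2 (g * X - g * lam * Y) ≤ b := by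
  rw [show g * X - g * lam * Y = g * (X - lam * Y) by ring, map_mul]
  calc _ ≤ 1 * b := mul_le_mul' hg h
    _ = b := one_mul b

/-! ## Odd row `2N+1`: ° cells only -/

section odd

variable {A B : ℕ} (hAB : 2 * B ≤ A) (hB : 1 ≤ B) {L N : ℕ} (hN : N < 2 ^ (L + 1)) {g : ℕ → ℚ}
  (hg : ∀ k, k ≤ 2 * N + 1 → Rat.padicValuation 2 (g k) ≤ 1)
include hAB hB hN hg

/-- **ONE-LEVEL REDUCTION at `2`, odd row, cells `s ≥ 1`**: with `W = blockWeight A B 0 2 1 N g` (the row `2N+1 = 1 + N·2`),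
`v₂(Σ_{k<2N+2} g(k)·2^{(L+1)(A−s)}c̃_{k,s}(2N+1) − Σ_{K<N+1} W(K)·2^{L(A−s)}c̃_{K,s}(N)) ≤ exp(−(L+1))`. -/
theorem level_reduction_two_odd (s : ℕ) :
    Rat.padicValuation 2 (∑ k ∈ range (2 * N + 1 + 1), g k * ((2 : ℚ) ^ ((L + 1) * (A - s)) * cell A B 0 (2 * N + 1) k s) -
      ∑ K ∈ range (N + 1), blockWeight A B 0 2 1 N g K * ((2 : ℚ) ^ (L * (A - s)) * cell A B 0 N K s)) ≤
      exp (-((L : ℤ) + 1)) := by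
  rw [sum_range_even_odd, ← Finset.sum_add_distrib, ← Finset.sum_sub_distrib]
  refine Valuation.map_sum_le _ fun K hK => ?_
  have hKN : K ≤ N := Nat.lt_succ_iff.1 (mem_range.1 hK)
  have hc0 : cTop A B 0 N K ≠ 0 := cTop_zero_ne_zero hKN A B
  -- the block weight at `K`: two digits `k₀ = 0, 1`
  have hW : blockWeight A B 0 2 1 N g K =
      g (2 * K) * (cTop A B 0 (2 * N + 1) (2 * K) / cTop A B 0 N K) +
        g (2 * K + 1) * (cTop A B 0 (2 * N + 1) (2 * K + 1) / cTop A B 0 N K) := by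
    rw [blockWeight, Finset.sum_range_succ, Finset.sum_range_one, zero_add, show 1 + N * 2 = 2 * N + 1 by ring,
      show K * 2 = 2 * K by ring, show 1 + 2 * K = 2 * K + 1 by ring]
  rw [hW, cTop_two_odd_even hAB hKN, cTop_two_odd_odd hAB hKN, mul_div_cancel_right₀ _ hc0, mul_div_cancel_right₀ _ hc0]
  have he := residueLaw_two_odd_even hAB hB hN hKN (A - s)
  have ho := residueLaw_two_odd_odd hAB hB hN hKN (A - s)
  have hge : Rat.padicValuation 2 (g (2 * K)) ≤ 1 := hg _ (by omega)
  have hgo : Rat.padicValuation 2 (g (2 * K + 1)) ≤ 1 := hg _ (by omega)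
  have h1 := term_le hge he
  have h2 := term_le hgo ho
  rw [show ∀ (a b c d e : ℚ), a + b - (c + d) * e = (a - c * e) + (b - d * e) from fun a b c d e => by ring]
  exact (Valuation.map_add _ _ _).trans (max_le h1 h2)

/-- **ONE-LEVEL REDUCTION at `2`, odd row, harmonic cell**:
`v₂(Σ_{k<2N+2} g(k)·2^{(L+1)A}c̃⁰_k(2N+1) − Σ_{K<N+1} W(K)·2^{LA}c̃⁰_K(N)) ≤ exp(−(L+1))`. -/
theorem level_reduction_two_odd_zero :
    Rat.padicValuation 2 (∑ k ∈ range (2 * N + 1 + 1), g k * ((2 : ℚ) ^ ((L + 1) * A) * cellZero A B 0 (2 * N + 1) k) -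
      ∑ K ∈ range (N + 1), blockWeight A B 0 2 1 N g K * ((2 : ℚ) ^ (L * A) * cellZero A B 0 N K)) ≤
      exp (-((L : ℤ) + 1)) := by
  rw [sum_range_even_odd, ← Finset.sum_add_distrib, ← Finset.sum_sub_distrib]
  refine Valuation.map_sum_le _ fun K hK => ?_
  have hKN : K ≤ N := Nat.lt_succ_iff.1 (mem_range.1 hK)
  have hc0 : cTop A B 0 N K ≠ 0 := cTop_zero_ne_zero hKN A B
  have hW : blockWeight A B 0 2 1 N g K =
      g (2 * K) * (cTop A B 0 (2 * N + 1) (2 * K) / cTop A B 0 N K) +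
        g (2 * K + 1) * (cTop A B 0 (2 * N + 1) (2 * K + 1) / cTop A B 0 N K) := by
    rw [blockWeight, Finset.sum_range_succ, Finset.sum_range_one, zero_add, show 1 + N * 2 = 2 * N + 1 by ring,
      show K * 2 = 2 * K by ring, show 1 + 2 * K = 2 * K + 1 by ring]
  rw [hW, cTop_two_odd_even hAB hKN, cTop_two_odd_odd hAB hKN, mul_div_cancel_right₀ _ hc0, mul_div_cancel_right₀ _ hc0]
  have h1 := term_le (hg (2 * K) (by omega)) (residueLawZero_two_odd_even hAB hB hN hKN)
  have h2 := term_le (hg (2 * K + 1) (by omega)) (residueLawZero_two_odd_odd hAB hB hN hKN)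
  rw [show ∀ (a b c d e : ℚ), a + b - (c + d) * e = (a - c * e) + (b - d * e) from fun a b c d e => by ring]
  exact (Valuation.map_add _ _ _).trans (max_le h1 h2)

end odd

/-! ## Even row `2N+2`: ° cells to the row `N+1`, holes to the row `N` -/

section even

variable {A B : ℕ} (hAB : 2 * B ≤ A) {L N : ℕ} (hN : N + 1 < 2 ^ (L + 1)) {g : ℕ → ℚ}
  (hg : ∀ k, k ≤ 2 * N + 2 → Rat.padicValuation 2 (g k) ≤ 1)
include hAB hN hg

/-- **ONE-LEVEL REDUCTION at `2`, even row, cells `s ≥ 1`**: with `W = blockWeight A B 0 2 0 (N+1) g` (row `2N+2 = 0 + (N+1)·2`)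
and `G = holeWeight A B 0 2 0 N g`, for `N + 1 < 2^{L+1}`, `1 ≤ A`:
`v₂(Σ_{k<2N+3} g(k)·2^{(L+1)(A−s)}c̃_{k,s}(2N+2) − Σ_{K<N+2} W(K)·2^{L(A−s)}c̃_{K,s}(N+1) − Σ_{K<N+1} G(K)·2^{L(A−s)}c̃_{K,s}(N))
≤ exp(−(L+1))`. -/
theorem level_reduction_two_even (hA : 1 ≤ A) (s : ℕ) :
    Rat.padicValuation 2 (∑ k ∈ range (2 * N + 2 + 1), g k * ((2 : ℚ) ^ ((L + 1) * (A - s)) * cell A B 0 (2 * N + 2) k s) -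
      ∑ K ∈ range (N + 1 + 1), blockWeight A B 0 2 0 (N + 1) g K * ((2 : ℚ) ^ (L * (A - s)) * cell A B 0 (N + 1) K s) -
      ∑ K ∈ range (N + 1), holeWeight A B 0 2 0 N g K * ((2 : ℚ) ^ (L * (A - s)) * cell A B 0 N K s)) ≤
      exp (-((L : ℤ) + 1)) := by
  have hN' : N < 2 ^ (L + 1) := by omega
  rw [sum_range_even_odd_succ, show ∀ (a b c d : ℚ), a + b - c - d = (a - c) + (b - d) from fun a b c d => by ring,
    ← Finset.sum_sub_distrib, ← Finset.sum_sub_distrib]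
  refine (Valuation.map_add _ _ _).trans (max_le (Valuation.map_sum_le _ fun K hK => ?_)
    (Valuation.map_sum_le _ fun K hK => ?_))
  · -- ° cell `2K` against the row `N+1`
    have hKN : K ≤ N + 1 := Nat.lt_succ_iff.1 (mem_range.1 hK)
    have hc0 : cTop A B 0 (N + 1) K ≠ 0 := cTop_zero_ne_zero hKN A B
    have hW : blockWeight A B 0 2 0 (N + 1) g K = g (2 * K) * (cTop A B 0 ((N + 1) * 2) (K * 2) / cTop A B 0 (N + 1) K) := by
      rw [blockWeight, Finset.sum_range_one, zero_add, zero_add, show K * 2 = 2 * K by ring]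
    rw [hW, cTop_two_even hAB hKN, mul_div_cancel_right₀ _ hc0]
    have he := residueLaw_two_even hAB hN hKN (A - s)
    rw [show (N + 1) * 2 = 2 * N + 2 by ring, show K * 2 = 2 * K by ring] at he
    exact term_le (hg (2 * K) (by omega)) he
  · -- hole `2K+1` against the row `N`
    have hKN : K ≤ N := Nat.lt_succ_iff.1 (mem_range.1 hK)
    have hc0 : cTop A B 0 N K ≠ 0 := cTop_zero_ne_zero hKN A B
    have hG : holeWeight A B 0 2 0 N g K = g (2 * K + 1) * (cTop A B 0 (2 * N + 2) (2 * K + 1) / cTop A B 0 N K) := by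
      rw [holeWeight, zero_add, Nat.Ico_succ_singleton, Finset.sum_singleton, zero_add, show (N + 1) * 2 = 2 * N + 2 by ring,
        show 1 + K * 2 = 2 * K + 1 by ring]
    rw [hG, cTop_two_hat hAB hKN, mul_div_cancel_right₀ _ hc0]
    exact term_le (hg (2 * K + 1) (by omega)) (residueLaw_two_hat hAB hN' hKN hA (A - s))

/-- **ONE-LEVEL REDUCTION at `2`, even row, harmonic cell** (`1 ≤ A`). -/
theorem level_reduction_two_even_zero (hA : 1 ≤ A) :
    Rat.padicValuation 2 (∑ k ∈ range (2 * N + 2 + 1), g k * ((2 : ℚ) ^ ((L + 1) * A) * cellZero A B 0 (2 * N + 2) k) -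
      ∑ K ∈ range (N + 1 + 1), blockWeight A B 0 2 0 (N + 1) g K * ((2 : ℚ) ^ (L * A) * cellZero A B 0 (N + 1) K) -
      ∑ K ∈ range (N + 1), holeWeight A B 0 2 0 N g K * ((2 : ℚ) ^ (L * A) * cellZero A B 0 N K)) ≤
      exp (-((L : ℤ) + 1)) := by
  have hN' : N < 2 ^ (L + 1) := by omega
  rw [sum_range_even_odd_succ, show ∀ (a b c d : ℚ), a + b - c - d = (a - c) + (b - d) from fun a b c d => by ring,
    ← Finset.sum_sub_distrib, ← Finset.sum_sub_distrib]
  refine (Valuation.map_add _ _ _).trans (max_le (Valuation.map_sum_le _ fun K hK => ?_)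
    (Valuation.map_sum_le _ fun K hK => ?_))
  · have hKN : K ≤ N + 1 := Nat.lt_succ_iff.1 (mem_range.1 hK)
    have hc0 : cTop A B 0 (N + 1) K ≠ 0 := cTop_zero_ne_zero hKN A B
    have hW : blockWeight A B 0 2 0 (N + 1) g K = g (2 * K) * (cTop A B 0 ((N + 1) * 2) (K * 2) / cTop A B 0 (N + 1) K) := by
      rw [blockWeight, Finset.sum_range_one, zero_add, zero_add, show K * 2 = 2 * K by ring]
    rw [hW, cTop_two_even hAB hKN, mul_div_cancel_right₀ _ hc0]
    have he := residueLawZero_two_even hAB hN hKN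
    rw [show (N + 1) * 2 = 2 * N + 2 by ring, show K * 2 = 2 * K by ring] at he
    exact term_le (hg (2 * K) (by omega)) he
  · have hKN : K ≤ N := Nat.lt_succ_iff.1 (mem_range.1 hK)
    have hc0 : cTop A B 0 N K ≠ 0 := cTop_zero_ne_zero hKN A B
    have hG : holeWeight A B 0 2 0 N g K = g (2 * K + 1) * (cTop A B 0 (2 * N + 2) (2 * K + 1) / cTop A B 0 N K) := by
      rw [holeWeight, zero_add, Nat.Ico_succ_singleton, Finset.sum_singleton, zero_add, show (N + 1) * 2 = 2 * N + 2 by ring,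
        show 1 + K * 2 = 2 * K + 1 by ring]
    rw [hG, cTop_two_hat hAB hKN, mul_div_cancel_right₀ _ hc0]
    exact term_le (hg (2 * K + 1) (by omega)) (residueLawZero_two_hat hAB hN' hKN hA)

end even

end

end Summit.KontsevichZagierPeriods.Zeta5Search.BrickLevelReductionTwo
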